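import Summits.Ventures.HodgeRepro2.T5SU11LegendreShiftedBridge
import Summits.Ventures.HodgeRepro2.T5SU11JacobiWeightDeriv2
import Summits.Ventures.HodgeRepro2.T5SU11JacobiPhaseMomentsFour

/-!
# The transform at the even integer parameters in product form: `m̂_k(2n+2) = (2π/(k−2)) Π_{i<n} (k+2i)/(k−4−2i)`;
the partial-fraction identity proved by the group; the mean phase and its variance at every even parameter

`T5SU11JacobiParamRecursion.jacobi_param_add_two_mul` (the two-step recursion in the parameter) iterated from
`m̂_k(2) = 2π/(k − 2)` (`φ_2 ≡ 1`) gives **the product form**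

  **`m̂_k(2n+2) = (2π/(k − 2)) · Π_{i<n} (k + 2i)/(k − 4 − 2i)`**   (`jacobi_even_eq_prod`, `k > 2n + 2`),

while `T5SU11LegendreShiftedBridge.jacobi_even_eq_explicit` gives the same integral as the partial-fraction sum
`2π Σ_{i≤n} (−1)^{n+i} C(n,i) C(n+i,n)/(k − 2 − 2i)`. Two computations of one integral prove **the partial-fraction
identity** `Σ_{i≤n} (−1)^{n+i} C(n,i) C(n+i,n)/(k − 2 − 2i) = (1/(k−2)) Π_{i<n} (k + 2i)/(k − 4 − 2i)` for every real
`k > 2n + 2` (`sum_partial_fraction_eq_prod`) — the agreement foreseen in S4.73.2 (xli), obtained here from the group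
rather than from a residue computation. Differentiating `log` of the product form in the weight
(`T5SU11JacobiWeightDeriv.deriv_log_jacobi_weight`, `T5SU11JacobiWeightDeriv2.deriv2_log_jacobi_weight`) gives the
first two cumulants of the phase `log|a(g)|` under `m_k φ_{2n+2} dν / m̂_k(2n+2)` at EVERY even parameter in closed
form:

  **`⟨log|a|⟩_{k,2n+2} = 1/(k−2) + Σ_{i<n} (1/(k−4−2i) − 1/(k+2i))`**   (`mean_phase_even_eq`),
  **`Var_{k,2n+2}(log|a|) = 1/(k−2)² + Σ_{i<n} (1/(k−4−2i)² − 1/(k+2i)²)`**   (`variance_phase_even_eq`),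

recovering at `n = 1` the values `(k² − 8)/(k(k−2)(k−4))` and `(k⁴ − 32k² + 96k − 64)/(k²(k−2)²(k−4)²)` of
`T5SU11JacobiPhaseMomentsFour` (`mean_phase_four_eq'`, `variance_phase_four_eq'`). Nothing is claimed about (N).

Blind lane: Mathlib + the HodgeRepro2 prefix only; no sorry; axioms ⊆ {propext, Classical.choice,
Quot.sound}.
-/

namespace Summit.Ventures.HodgeRepro2.T5SU11JacobiEvenProduct

open MeasureTheory Metric Set Filter Topology Finset
open T5SU11Unimodular T5SU11Fibration T5SU11Cartan T5SU11OneParameter T5SU11CartanProjection T5HaarCircle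
  T5BergmanCoefficient T5SU11FibrationHaar T5SU11SphericalFunction T5SU11SphericalTwo T5SU11JacobiIwasawa
  T5SU11JacobiParamRecursion T5SU11KFiniteMajorantPow T5SU11JacobiWeightDeriv T5SU11JacobiWeightDeriv2
  T5SU11LegendreShiftedBridge T5SU11JacobiPhaseMomentsFour
open scoped Real

/-! ### The product and its logarithm -/

/-- **`Π_{i<n} (k + 2i)/(k − 4 − 2i)`.** -/
noncomputable def evenProd (n : ℕ) (k : ℝ) : ℝ := ∏ i ∈ range n, (k + 2 * i) / (k - 4 - 2 * i)

/-- **`log(2π) − log(k − 2) + Σ_{i<n} (log(k + 2i) − log(k − 4 − 2i))`**, the logarithm of the product form. -/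
noncomputable def logProd (n : ℕ) (k : ℝ) : ℝ :=
  Real.log (2 * π) - Real.log (k - 2) + ∑ i ∈ range n, (Real.log (k + 2 * i) - Real.log (k - 4 - 2 * i))

/-- **Minus the derivative of `logProd`**: `1/(k − 2) + Σ_{i<n} (1/(k − 4 − 2i) − 1/(k + 2i))`. -/
noncomputable def meanProd (n : ℕ) (k : ℝ) : ℝ :=
  (k - 2)⁻¹ + ∑ i ∈ range n, ((k - 4 - 2 * i)⁻¹ - (k + 2 * i)⁻¹)

/-- **Minus the derivative of `meanProd`**: `1/(k − 2)² + Σ_{i<n} (1/(k − 4 − 2i)² − 1/(k + 2i)²)`. -/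
noncomputable def varProd (n : ℕ) (k : ℝ) : ℝ :=
  ((k - 2) ^ 2)⁻¹ + ∑ i ∈ range n, (((k - 4 - 2 * i) ^ 2)⁻¹ - ((k + 2 * i) ^ 2)⁻¹)

/-- The factors are positive for `k > 2n + 2`, `i < n`. -/
theorem factor_pos {n : ℕ} {k : ℝ} (hk : 2 * (n : ℝ) + 2 < k) {i : ℕ} (hi : i ∈ range n) :
    0 < k + 2 * i ∧ 0 < k - 4 - 2 * i := by
  have hi' : (i : ℝ) + 1 ≤ n := by exact_mod_cast Finset.mem_range.mp hi
  have : (0 : ℝ) ≤ i := Nat.cast_nonneg i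
  constructor <;> linarith

/-- `evenProd n k > 0` for `k > 2n + 2`. -/
theorem evenProd_pos (n : ℕ) {k : ℝ} (hk : 2 * (n : ℝ) + 2 < k) : 0 < evenProd n k :=
  Finset.prod_pos fun _ hi => div_pos (factor_pos hk hi).1 (factor_pos hk hi).2

/-- `log (2π/(k − 2) · evenProd n k) = logProd n k` for `k > 2n + 2`. -/
theorem log_evenProd (n : ℕ) {k : ℝ} (hk : 2 * (n : ℝ) + 2 < k) :
    Real.log (2 * π / (k - 2) * evenProd n k) = logProd n k := by
  have hn : (0 : ℝ) ≤ n := Nat.cast_nonneg n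
  have h2 : k - 2 ≠ 0 := by linarith
  rw [Real.log_mul (by positivity) (evenProd_pos n hk).ne', Real.log_div (by positivity) h2, evenProd,
    Real.log_prod fun i hi => (div_pos (factor_pos hk hi).1 (factor_pos hk hi).2).ne', logProd]
  congr 1
  refine Finset.sum_congr rfl fun i hi => ?_
  rw [Real.log_div (factor_pos hk hi).1.ne' (factor_pos hk hi).2.ne']

/-- `(log(y + c))' = (k + c)⁻¹`. -/
theorem hasDerivAt_log_add (c : ℝ) {k : ℝ} (h : k + c ≠ 0) :
    HasDerivAt (fun y : ℝ => Real.log (y + c)) (k + c)⁻¹ k := by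
  have := ((hasDerivAt_id' k).add_const c).log h
  simpa [one_div] using this

/-- `(log(y − c))' = (k − c)⁻¹`. -/
theorem hasDerivAt_log_sub (c : ℝ) {k : ℝ} (h : k - c ≠ 0) :
    HasDerivAt (fun y : ℝ => Real.log (y - c)) (k - c)⁻¹ k := by
  have := ((hasDerivAt_id' k).sub_const c).log h
  simpa [one_div] using this

/-- `((y + c)⁻¹)' = −((k + c)²)⁻¹`. -/
theorem hasDerivAt_inv_add (c : ℝ) {k : ℝ} (h : k + c ≠ 0) :
    HasDerivAt (fun y : ℝ => (y + c)⁻¹) (-((k + c) ^ 2)⁻¹) k := by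
  have := ((hasDerivAt_id' k).add_const c).inv h
  refine (this.congr_deriv ?_).congr_of_eventuallyEq (Filter.Eventually.of_forall fun y => ?_)
  · rw [neg_div, one_div]
  · rfl

/-- `((y − c)⁻¹)' = −((k − c)²)⁻¹`. -/
theorem hasDerivAt_inv_sub (c : ℝ) {k : ℝ} (h : k - c ≠ 0) :
    HasDerivAt (fun y : ℝ => (y - c)⁻¹) (-((k - c) ^ 2)⁻¹) k := by
  have := ((hasDerivAt_id' k).sub_const c).inv h
  refine (this.congr_deriv ?_).congr_of_eventuallyEq (Filter.Eventually.of_forall fun y => ?_)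
  · rw [neg_div, one_div]
  · rfl

/-- **`(logProd n)' = −meanProd n`** for `k > 2n + 2`. -/
theorem hasDerivAt_logProd (n : ℕ) {k : ℝ} (hk : 2 * (n : ℝ) + 2 < k) :
    HasDerivAt (logProd n) (-meanProd n k) k := by
  have hn : (0 : ℝ) ≤ n := Nat.cast_nonneg n
  have h2 : k - 2 ≠ 0 := by linarith
  have hA : ∀ i ∈ range n, HasDerivAt (fun k : ℝ => Real.log (k + 2 * i) - Real.log (k - 4 - 2 * i))
      ((k + 2 * i)⁻¹ - (k - 4 - 2 * i)⁻¹) k := fun i hi => by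
    have h1 := hasDerivAt_log_add (2 * (i : ℝ)) (factor_pos hk hi).1.ne'
    have h2 := hasDerivAt_log_sub (4 + 2 * (i : ℝ)) (by have := (factor_pos hk hi).2; intro h; linarith)
    refine ((h1.sub h2).congr_deriv ?_).congr_of_eventuallyEq (Filter.Eventually.of_forall fun y => ?_)
    · rw [show k - (4 + 2 * (i : ℝ)) = k - 4 - 2 * i by ring]
    · simp only [Pi.sub_apply]
      rw [show y - (4 + 2 * (i : ℝ)) = y - 4 - 2 * i by ring]
  have hsum := HasDerivAt.sum hA
  have hlog := hasDerivAt_log_sub 2 h2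
  have h := (hlog.const_sub (Real.log (2 * π))).add hsum
  refine (h.congr_deriv ?_).congr_of_eventuallyEq (Filter.Eventually.of_forall fun y => ?_)
  · simp only [meanProd, neg_add, ← Finset.sum_neg_distrib, neg_sub]
  · simp only [logProd, Pi.add_apply, Finset.sum_apply]

/-- **`(meanProd n)' = −varProd n`** for `k > 2n + 2`. -/
theorem hasDerivAt_meanProd (n : ℕ) {k : ℝ} (hk : 2 * (n : ℝ) + 2 < k) :
    HasDerivAt (meanProd n) (-varProd n k) k := by
  have hn : (0 : ℝ) ≤ n := Nat.cast_nonneg n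
  have h2 : k - 2 ≠ 0 := by linarith
  have hA : ∀ i ∈ range n, HasDerivAt (fun k : ℝ => (k - 4 - 2 * i)⁻¹ - (k + 2 * i)⁻¹)
      (-((k - 4 - 2 * i) ^ 2)⁻¹ - -((k + 2 * i) ^ 2)⁻¹) k := fun i hi => by
    have h1 := hasDerivAt_inv_add (2 * (i : ℝ)) (factor_pos hk hi).1.ne'
    have h2 := hasDerivAt_inv_sub (4 + 2 * (i : ℝ)) (by have := (factor_pos hk hi).2; intro h; linarith)
    refine ((h2.sub h1).congr_deriv ?_).congr_of_eventuallyEq (Filter.Eventually.of_forall fun y => ?_)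
    · rw [show k - (4 + 2 * (i : ℝ)) = k - 4 - 2 * i by ring]
    · simp only [Pi.sub_apply]
      rw [show y - (4 + 2 * (i : ℝ)) = y - 4 - 2 * i by ring]
  have hsum := HasDerivAt.sum hA
  have hinv := hasDerivAt_inv_sub 2 h2
  have h := hinv.add hsum
  refine (h.congr_deriv ?_).congr_of_eventuallyEq (Filter.Eventually.of_forall fun y => ?_)
  · simp only [varProd, neg_add, ← Finset.sum_neg_distrib, neg_sub, sub_neg_eq_add]
    congr 1
    refine Finset.sum_congr rfl fun i _ => ?_
    ring
  · simp only [meanProd, Pi.add_apply, Finset.sum_apply]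

section measure

variable [MeasurableSpace Circle] [BorelSpace Circle]

/-! ### The product form -/

/-- **`m̂_k(2) = 2π/(k − 2)`** (`φ_2 ≡ 1`). -/
theorem jacobi_two {k : ℝ} (hk : 2 < k) :
    ∫ g, (1 - ‖orbit g‖ ^ 2) ^ (k / 2) * sph 2 g ∂(nu haarCircle) = 2 * π / (k - 2) := by
  simp_rw [sph_two, mul_one]
  exact integral_orbit_rpow_nu hk

/-- **THE PRODUCT FORM: `m̂_k(2n+2) = (2π/(k − 2)) · Π_{i<n} (k + 2i)/(k − 4 − 2i)`** for `k > 2n + 2`. -/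
theorem jacobi_even_eq_prod (n : ℕ) {k : ℝ} (hk : 2 * (n : ℝ) + 2 < k) :
    ∫ g, (1 - ‖orbit g‖ ^ 2) ^ (k / 2) * sph (2 * (n : ℝ) + 2) g ∂(nu haarCircle)
      = 2 * π / (k - 2) * evenProd n k := by
  have hn : (0 : ℝ) ≤ n := Nat.cast_nonneg n
  have h := jacobi_param_add_two_mul (k := k) (lam := 2) (by linarith) (by linarith) n (by linarith)
  rw [show (2 : ℝ) + 2 * (n : ℝ) = 2 * (n : ℝ) + 2 by ring, jacobi_two (by linarith)] at h
  rw [h, evenProd, mul_comm]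
  congr 1
  refine Finset.prod_congr rfl fun i _ => ?_
  congr 1 <;> ring

/-- **`log m̂_k(2n+2) = logProd n k`** for `k > 2n + 2`. -/
theorem log_jacobi_even_eq (n : ℕ) {k : ℝ} (hk : 2 * (n : ℝ) + 2 < k) :
    Real.log (∫ g, (1 - ‖orbit g‖ ^ 2) ^ (k / 2) * sph (2 * (n : ℝ) + 2) g ∂(nu haarCircle)) = logProd n k := by
  rw [jacobi_even_eq_prod n hk, log_evenProd n hk]

/-- The cross-check `n = 1`: `m̂_k(4) = 2πk/((k − 2)(k − 4))` (`T5SU11JacobiPhaseLawInteger`). -/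
theorem jacobi_four_eq_prod {k : ℝ} (hk : 4 < k) :
    ∫ g, (1 - ‖orbit g‖ ^ 2) ^ (k / 2) * sph 4 g ∂(nu haarCircle) = 2 * π * k / ((k - 2) * (k - 4)) := by
  have h := jacobi_even_eq_prod 1 (k := k) (by push_cast; linarith)
  rw [show (2 * ((1 : ℕ) : ℝ) + 2) = 4 by norm_num] at h
  rw [h, evenProd, Finset.prod_range_one]
  have h2 : k - 2 ≠ 0 := by intro h; linarith
  have h4 : k - 4 ≠ 0 := by intro h; linarith
  simp only [Nat.cast_zero, mul_zero, add_zero, sub_zero]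
  field_simp

end measure

/-! ### The partial-fraction identity, proved by the group -/

/-- **`Σ_{i≤n} (−1)^{n+i} C(n,i) C(n+i,n)/(k − 2 − 2i) = (1/(k − 2)) Π_{i<n} (k + 2i)/(k − 4 − 2i)`** for every real
`k > 2n + 2`: the two evaluations of `m̂_k(2n+2)` (the partial-fraction sum of the phase law and the product form of the
parameter recursion) agree. -/
theorem sum_partial_fraction_eq_prod (n : ℕ) {k : ℝ} (hk : 2 * (n : ℝ) + 2 < k) :
    ∑ i ∈ range (n + 1), (-1) ^ (n + i) * (n.choose i : ℝ) * ((n + i).choose n : ℝ) / (k - 2 - 2 * (i : ℝ))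
      = evenProd n k / (k - 2) := by
  letI : MeasurableSpace Circle := borel Circle
  haveI : BorelSpace Circle := ⟨rfl⟩
  have h1 := jacobi_even_eq_explicit n hk
  have h2 := jacobi_even_eq_prod n hk
  rw [h1] at h2
  have hπ : (2 * π : ℝ) ≠ 0 := by positivity
  refine mul_left_cancel₀ hπ ?_
  rw [h2]
  ring

/-- The cross-check `n = 1`: `2/(k − 4) − 1/(k − 2) = k/((k − 2)(k − 4))`. -/
theorem sum_partial_fraction_one {k : ℝ} (hk : 4 < k) :
    2 / (k - 4) - 1 / (k - 2) = k / ((k - 2) * (k - 4)) := by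
  have h2 : k - 2 ≠ 0 := by intro h; linarith
  have h4 : k - 4 ≠ 0 := by intro h; linarith
  field_simp
  ring

section measure

variable [MeasurableSpace Circle] [BorelSpace Circle]

/-! ### The mean phase and its variance at every even parameter -/

/-- **`⟨log|a|⟩_{k,2n+2} = 1/(k − 2) + Σ_{i<n} (1/(k − 4 − 2i) − 1/(k + 2i))`** for `k > 2n + 2`. -/
theorem mean_phase_even_eq (n : ℕ) {k : ℝ} (hk : 2 * (n : ℝ) + 2 < k) :
    (∫ g, Real.log ‖mat g 0 0‖ * ((1 - ‖orbit g‖ ^ 2) ^ (k / 2) * sph (2 * (n : ℝ) + 2) g) ∂(nu haarCircle))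
        / (∫ g, (1 - ‖orbit g‖ ^ 2) ^ (k / 2) * sph (2 * (n : ℝ) + 2) g ∂(nu haarCircle))
      = meanProd n k := by
  have hn : (0 : ℝ) ≤ n := Nat.cast_nonneg n
  have hd := deriv_log_jacobi_weight (k := k) (lam := 2 * (n : ℝ) + 2) (by linarith) hk (by linarith)
  have heq : (fun k => Real.log (∫ g, (1 - ‖orbit g‖ ^ 2) ^ (k / 2) * sph (2 * (n : ℝ) + 2) g ∂(nu haarCircle)))
      =ᶠ[𝓝 k] logProd n :=
    Filter.eventuallyEq_of_mem (isOpen_Ioi.mem_nhds hk) fun k' hk' => log_jacobi_even_eq n hk'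
  rw [heq.deriv_eq, (hasDerivAt_logProd n hk).deriv] at hd
  linear_combination hd

/-- On the whole ray `k > 2n + 2`, `deriv (log m̂_·(2n+2)) = −meanProd n` near `k`. -/
theorem deriv_log_jacobi_even_eventuallyEq (n : ℕ) {k : ℝ} (hk : 2 * (n : ℝ) + 2 < k) :
    deriv (fun k => Real.log (∫ g, (1 - ‖orbit g‖ ^ 2) ^ (k / 2) * sph (2 * (n : ℝ) + 2) g ∂(nu haarCircle)))
      =ᶠ[𝓝 k] -meanProd n :=
  Filter.eventuallyEq_of_mem (isOpen_Ioi.mem_nhds hk) fun k' hk' => by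
    have heq : (fun k => Real.log (∫ g, (1 - ‖orbit g‖ ^ 2) ^ (k / 2) * sph (2 * (n : ℝ) + 2) g ∂(nu haarCircle)))
        =ᶠ[𝓝 k'] logProd n :=
      Filter.eventuallyEq_of_mem (isOpen_Ioi.mem_nhds hk') fun k'' hk'' => log_jacobi_even_eq n hk''
    rw [heq.deriv_eq, (hasDerivAt_logProd n hk').deriv, Pi.neg_apply]

/-- **`Var_{k,2n+2}(log|a|) = 1/(k − 2)² + Σ_{i<n} (1/(k − 4 − 2i)² − 1/(k + 2i)²)`** for `k > 2n + 2`. -/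
theorem variance_phase_even_eq (n : ℕ) {k : ℝ} (hk : 2 * (n : ℝ) + 2 < k) :
    (∫ g, Real.log ‖mat g 0 0‖ ^ 2 * ((1 - ‖orbit g‖ ^ 2) ^ (k / 2) * sph (2 * (n : ℝ) + 2) g) ∂(nu haarCircle))
        / (∫ g, (1 - ‖orbit g‖ ^ 2) ^ (k / 2) * sph (2 * (n : ℝ) + 2) g ∂(nu haarCircle))
      - ((∫ g, Real.log ‖mat g 0 0‖ * ((1 - ‖orbit g‖ ^ 2) ^ (k / 2) * sph (2 * (n : ℝ) + 2) g) ∂(nu haarCircle))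
        / (∫ g, (1 - ‖orbit g‖ ^ 2) ^ (k / 2) * sph (2 * (n : ℝ) + 2) g ∂(nu haarCircle))) ^ 2
      = varProd n k := by
  have hn : (0 : ℝ) ≤ n := Nat.cast_nonneg n
  have hd := deriv2_log_jacobi_weight (k := k) (lam := 2 * (n : ℝ) + 2) (by linarith) hk (by linarith)
  rw [(deriv_log_jacobi_even_eventuallyEq n hk).deriv_eq, (hasDerivAt_meanProd n hk).neg.deriv, neg_neg] at hd
  exact hd.symm

/-- The cross-check `n = 1`: `⟨log|a|⟩_{k,4} = (k² − 8)/(k(k − 2)(k − 4))` (`T5SU11JacobiPhaseMomentsFour`). -/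
theorem mean_phase_four_eq' {k : ℝ} (hk : 4 < k) :
    (∫ g, Real.log ‖mat g 0 0‖ * ((1 - ‖orbit g‖ ^ 2) ^ (k / 2) * sph 4 g) ∂(nu haarCircle))
        / (∫ g, (1 - ‖orbit g‖ ^ 2) ^ (k / 2) * sph 4 g ∂(nu haarCircle))
      = (k ^ 2 - 8) / (k * (k - 2) * (k - 4)) := by
  have h := mean_phase_even_eq 1 (k := k) (by push_cast; linarith)
  rw [show (2 * ((1 : ℕ) : ℝ) + 2) = 4 by norm_num] at h
  rw [h, meanProd, Finset.sum_range_one]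
  have h2 : k - 2 ≠ 0 := by intro h; linarith
  have h4 : k - 4 ≠ 0 := by intro h; linarith
  have h0 : k ≠ 0 := by intro h; linarith
  simp only [Nat.cast_zero, mul_zero, sub_zero, add_zero]
  field_simp
  ring

/-- The cross-check `n = 1`: `Var_{k,4}(log|a|) = (k⁴ − 32k² + 96k − 64)/(k²(k − 2)²(k − 4)²)`. -/
theorem variance_phase_four_eq' {k : ℝ} (hk : 4 < k) :
    (∫ g, Real.log ‖mat g 0 0‖ ^ 2 * ((1 - ‖orbit g‖ ^ 2) ^ (k / 2) * sph 4 g) ∂(nu haarCircle))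
        / (∫ g, (1 - ‖orbit g‖ ^ 2) ^ (k / 2) * sph 4 g ∂(nu haarCircle))
      - ((∫ g, Real.log ‖mat g 0 0‖ * ((1 - ‖orbit g‖ ^ 2) ^ (k / 2) * sph 4 g) ∂(nu haarCircle))
        / (∫ g, (1 - ‖orbit g‖ ^ 2) ^ (k / 2) * sph 4 g ∂(nu haarCircle))) ^ 2
      = (k ^ 4 - 32 * k ^ 2 + 96 * k - 64) / (k ^ 2 * (k - 2) ^ 2 * (k - 4) ^ 2) := by
  have h := variance_phase_even_eq 1 (k := k) (by push_cast; linarith)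
  rw [show (2 * ((1 : ℕ) : ℝ) + 2) = 4 by norm_num] at h
  rw [h, varProd, Finset.sum_range_one]
  have h2 : k - 2 ≠ 0 := by intro h; linarith
  have h4 : k - 4 ≠ 0 := by intro h; linarith
  have h0 : k ≠ 0 := by intro h; linarith
  simp only [Nat.cast_zero, mul_zero, sub_zero, add_zero]
  field_simp
  ring

/-- The two values of `T5SU11JacobiPhaseMomentsFour` agree with the product form: the variance at `λ = 4` equals
`⟨s²⟩ − ⟨s⟩²` computed there. -/
theorem variance_phase_four_consistent {k : ℝ} (hk : 4 < k) :
    (∫ g, Real.log ‖mat g 0 0‖ ^ 2 * ((1 - ‖orbit g‖ ^ 2) ^ (k / 2) * sph 4 g) ∂(nu haarCircle))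
        / (∫ g, (1 - ‖orbit g‖ ^ 2) ^ (k / 2) * sph 4 g ∂(nu haarCircle))
      = (k ^ 4 - 32 * k ^ 2 + 96 * k - 64) / (k ^ 2 * (k - 2) ^ 2 * (k - 4) ^ 2)
        + ((k ^ 2 - 8) / (k * (k - 2) * (k - 4))) ^ 2 := by
  have h := variance_phase_four_eq' hk
  rw [mean_phase_four_eq' hk] at h
  linear_combination h

end measure

end Summit.Ventures.HodgeRepro2.T5SU11JacobiEvenProduct
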